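import Summits.NavierStokesRegularity.OSWSelfSimilar.TypeIIInnerLimitOfAxisymBlowup
import Summits.NavierStokesRegularity.NavierStokesRegularity.Theses.TypeIIInviscidRelaxation
import Summits.NavierStokesRegularity.NavierStokesRegularity.Theorems.TypeIIInviscidRelaxationOneSidedRadialCriterionZoomGate
import HarnessLib

/-!
# A gated axisymmetric singularity: its inner object carries the one-sided gate globally (any `ν > 0`)

Helper toward the crux `OneSidedRadialCriterion` (stmt-NavierStokesRegularity-19059, route TypeIIInviscidRelaxation, line
`subcritical_core_reynolds`; stub `stub_subcriticalCoreReynolds` ⟺ crux by name).  Companion of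
`TypeIIInviscidRelaxationOneSidedRadialCriterionZoomGate.lean` (gate inheritance for ANY sup-zoom).  Here the inheritance is
composed with the tree's UNCONDITIONAL inner-object theorem for the witness class
(`OSWSelfSimilar.TypeIIModulationDictionary.innerObject_master_of_axisymBlowupWitness`, any viscosity: gauge zoom
`(λₖ/ν) u(tₖ + (λₖ²/ν)s, cₖ + λₖ y)` at centres `cₖ`, `λₖ → 0`, `tₖ → T`, converging locally uniformly on negative slices
to a KNSS blow-up limit `W`; EITHER (α) `W ≡ c`, `‖c‖ = 1`, `c₁ = 0`, with zoomed vorticity `→ 0`, OR (β) the centres lie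
ON the axis and `W` REFUTES the bounded-swirl axisymmetric Liouville conjecture `AxisymmetricLiouvilleBoundedSwirl`:
axisymmetric slices, `|Γ_W| ≤ Mₛ/ν`, non-constant, with swirl, non-decaying swirl at large radius).

**What is proved.**
* `zoomGate_onAxis_of_tendsto` — for zooms centred ON the axis with the `(λ/ν)` gauge, the gate `x₀u₀ + x₁u₁ ≥ -Cν` on
  the tube `{cylRadius < δ}` passes to every pointwise slice limit as the GLOBAL unit-viscosity gate
  `y₀W₀(s,y) + y₁W₁(s,y) ≥ -C` (`r W_r ≥ -C` about the axis of `W`, all `s < 0`, all `y`).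
* `innerObject_gate_of_gatedBlowup` — under the crux's hypotheses (any `ν`) with gate constant `C` and
  `¬ HasSmoothExtensionPast`: the inner object of the tree with, in branch (β), the EXTRA conclusion `r W_r ≥ -C` globally.
* `innerObject_of_not_oneSidedRadialCriterion` — BY NAME: if the crux fails, some gated witness produces either a
  velocity-dominated inner object (α) or a counterexample to `AxisymmetricLiouvilleBoundedSwirl` obeying the global
  one-sided gate `r W_r ≥ -C` (β).

Reading for the line (R4 of the census): the open half `C ≥ 2`, seen through the inner object, is the ONE-SIDED bounded-swirl
Liouville problem "bounded ancient mild axisymmetric `W` with `|Γ_W|` bounded and `r W_r ≥ -C` everywhere is constant"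
— PLUS the exclusion of the velocity-dominated branch (α), which no Liouville theorem addresses (KNSS's Type-II caveat).  In
(β) the obstruction is conjugated, not removed: near the axis of `W` the drift is bounded (`|W| ≤ 1`), but the blow-down
`Γ_W(λy, λ²s)`, `λ → ∞`, lives again in the one-sided scale-invariant drift class where the tree's no-barrier theorems
(`RadialInflowBarrierWallT`) apply.  Nothing here proves `OneSidedRadialCriterion`, `AxisymSwirlRegular` or
NavierStokesRegularity.

References: H. Koch, N. Nadirashvili, G. Seregin, V. Šverák, Acta Math. 203 (2009) = arXiv:0709.3599, §5–§6
[KochNadirashviliSereginSverak2009]; G. Seregin, V. Šverák, arXiv:0804.1803, §3 [SereginSverak2009].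
-/

set_option linter.dupNamespace false

noncomputable section

open Set Function Filter Topology Metric
open scoped NNReal ENNReal

namespace Summit.NavierStokesRegularity.NavierStokesRegularity.Theorems.OneSidedZoomGate

open Literature.Analysis Literature.Analysis.FluidPDE
open Summit.NavierStokesRegularity.OSWSelfSimilar.TypeIIModulationDictionary

/-! ## §1 Zooms centred on the axis inherit the gate -/

/-- **On-axis zooms inherit the gate** (any `ν > 0`).  Gate `x₀u₀ + x₁u₁ ≥ -Cν` on `{cylRadius < δ} × [0,T)`; centres
`cₖ` ON the axis, scales `λₖ > 0`, `λₖ → 0`, times with `T/2 ≤ tₖ < T`; `W` a pointwise limit of the gauge zoom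
`(λₖ/ν) u(tₖ + (λₖ²/ν)s, cₖ + λₖ y)` on the slices `s < 0`.  Then `y₀ W₀(s,y) + y₁ W₁(s,y) ≥ -C` for all `s < 0`, `y`:
at the zoomed point `ξ = cₖ + λₖy` one has `ξ·u = λₖ (ν/λₖ)(y₀V₀ + y₁V₁) = ν (y₀V₀ + y₁V₁)`, and `cylRadius ξ = λₖ·cylRadius y → 0`.
[cite: KochNadirashviliSereginSverak2009, §6 (the zoom)] -/
theorem zoomGate_onAxis_of_tendsto {ν T C δ : ℝ} (hν : 0 < ν) (hT : 0 < T) (hδ : 0 < δ)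
    {u : ℝ → (EuclideanSpace ℝ (Fin 3)) → (EuclideanSpace ℝ (Fin 3))}
    (hgate : ∀ t ∈ Ico 0 T, ∀ x : EuclideanSpace ℝ (Fin 3), cylRadius x < δ →
      -(C * ν) ≤ x 0 * u t x 0 + x 1 * u t x 1)
    {t lam : ℕ → ℝ} {c : ℕ → EuclideanSpace ℝ (Fin 3)}
    (htn : ∀ k, T / 2 ≤ t k ∧ t k < T) (hlam : ∀ k, 0 < lam k) (hlam0 : Tendsto lam atTop (𝓝 0))
    (hc : ∀ k, c k 0 = 0 ∧ c k 1 = 0)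
    {W : ℝ → (EuclideanSpace ℝ (Fin 3)) → (EuclideanSpace ℝ (Fin 3))}
    (hpt : ∀ s < 0, ∀ y : EuclideanSpace ℝ (Fin 3), Tendsto
      (fun k => (lam k / ν) • u (t k + lam k ^ 2 / ν * s) (c k + lam k • y)) atTop (𝓝 (W s y))) :
    ∀ s < 0, ∀ y : EuclideanSpace ℝ (Fin 3), -C ≤ y 0 * W s y 0 + y 1 * W s y 1 := by
  intro s hs y
  -- the zoomed time is eventually in `[0,T)`
  have hlam0' : Tendsto (fun k => lam k / Real.sqrt ν) atTop (𝓝 0) := by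
    simpa using hlam0.div_const (Real.sqrt ν)
  have htime : ∀ᶠ k in atTop, t k + lam k ^ 2 / ν * s ∈ Ico 0 T := by
    have h := eventually_zoomTime_mem_Ico (tn := t) (lamn := fun k => lam k / Real.sqrt ν) htn hlam0' hT hs.le
    refine h.mono fun k hk => ?_
    have e : (lam k / Real.sqrt ν) ^ 2 * s = lam k ^ 2 / ν * s := by
      rw [div_pow, Real.sq_sqrt hν.le]
    rwa [e] at hk
  -- the zoomed point is eventually in the tube
  have hpoint : ∀ᶠ k in atTop, cylRadius (c k + lam k • y) < δ := by
    have h : Tendsto (fun k => lam k * ‖y‖) atTop (𝓝 (0 * ‖y‖)) := hlam0.mul_const _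
    rw [zero_mul] at h
    filter_upwards [(tendsto_order.1 h).2 _ hδ] with k hk
    have h1 := cylRadius_le_cylRadius_add_norm_sub (c k) (c k + lam k • y)
    have h0 : cylRadius (c k) = 0 := (cylRadius_eq_zero_iff _).2 (hc k)
    have e : ‖c k + lam k • y - c k‖ = lam k * ‖y‖ := by
      rw [add_sub_cancel_left, norm_smul, Real.norm_eq_abs, abs_of_pos (hlam k)]
    linarith
  -- the gate along the zoom
  have hgateV : ∀ᶠ k in atTop,
      -C ≤ y 0 * ((lam k / ν) • u (t k + lam k ^ 2 / ν * s) (c k + lam k • y)) 0 +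
        y 1 * ((lam k / ν) • u (t k + lam k ^ 2 / ν * s) (c k + lam k • y)) 1 := by
    filter_upwards [htime, hpoint] with k hk1 hk2
    set τ : ℝ := t k + lam k ^ 2 / ν * s with hτ
    set ξ : EuclideanSpace ℝ (Fin 3) := c k + lam k • y with hξ
    have hg := hgate τ hk1 ξ hk2
    have e0 : ξ 0 = lam k * y 0 := by
      rw [hξ, PiLp.add_apply, PiLp.smul_apply, smul_eq_mul, (hc k).1, zero_add]
    have e1 : ξ 1 = lam k * y 1 := by
      rw [hξ, PiLp.add_apply, PiLp.smul_apply, smul_eq_mul, (hc k).2, zero_add]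
    have eV : ∀ i, ((lam k / ν) • u τ ξ) i = lam k / ν * u τ ξ i := fun i => by
      rw [PiLp.smul_apply, smul_eq_mul]
    rw [eV 0, eV 1]
    have hlk := hlam k
    have key : ξ 0 * u τ ξ 0 + ξ 1 * u τ ξ 1 =
        ν * (y 0 * (lam k / ν * u τ ξ 0) + y 1 * (lam k / ν * u τ ξ 1)) := by
      rw [e0, e1]; field_simp
    rw [key] at hg
    -- `-(C ν) ≤ ν · X` ⇒ `-C ≤ X`
    by_contra hcon
    push Not at hcon
    nlinarith
  -- limits of the components
  have hlim : Tendsto (fun k => y 0 * ((lam k / ν) • u (t k + lam k ^ 2 / ν * s) (c k + lam k • y)) 0 +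
      y 1 * ((lam k / ν) • u (t k + lam k ^ 2 / ν * s) (c k + lam k • y)) 1) atTop
      (𝓝 (y 0 * W s y 0 + y 1 * W s y 1)) :=
    ((((continuous_apply_coord 0).tendsto _).comp (hpt s hs y)).const_mul _).add
      ((((continuous_apply_coord 1).tendsto _).comp (hpt s hs y)).const_mul _)
  exact ge_of_tendsto hlim hgateV

/-! ## §2 The inner object of a gated singularity -/

/-- **Inner object of a gated axisymmetric singularity, with the inherited gate** (any `ν > 0`).  Under the hypotheses of
`OneSidedRadialCriterion` (classical on `[0,T)`, Leray–Hopf, axisymmetric slices, rapidly decaying datum; the sub-slab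
bound is not needed here) with gate constant `C` on `{cylRadius < δ}`, and `¬ HasSmoothExtensionPast ν 0 u T`: there are a
swirl bound `Mₛ` of the datum, gauge zoom data `tₖ → T` (`T/2 ≤ tₖ < T`), `λₖ > 0 → 0`, centres `cₖ` with `cylRadius cₖ → 0`,
a subsequence `φ` and a KNSS blow-up limit `W` of the zoom (locally uniform on negative slices), such that EITHER
(α) `W ≡ c` with `‖c‖ = 1`, `c₁ = 0`, OR (β) the centres lie on the axis, `AxisymmetricLiouvilleBoundedSwirl` fails, `W`
has axisymmetric slices with `|Γ_W| ≤ Mₛ/ν`, is non-constant, has swirl somewhere and NON-DECAYING swirl at large radius,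
AND obeys the global one-sided gate `y₀W₀ + y₁W₁ ≥ -C` on `(-∞,0) × ℝ³`.
[cite: KochNadirashviliSereginSverak2009, §6 Prop. 6.1; SereginSverak2009, §3] -/
theorem innerObject_gate_of_gatedBlowup {ν T C δ : ℝ} (hν : 0 < ν) (hT : 0 < T) (hδ : 0 < δ)
    {u : ℝ → (EuclideanSpace ℝ (Fin 3)) → (EuclideanSpace ℝ (Fin 3))} {p : ℝ → (EuclideanSpace ℝ (Fin 3)) → ℝ}
    (hcl : IsClassicalNSSolutionOn (Ico 0 T) ν 0 u p) (hLH : IsLerayHopfOn T ν 0 (u 0) u)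
    (hax : ∀ t ∈ Ico 0 T, IsAxisymmetric (u t)) (hdec : HasRapidSpatialDecay (u 0))
    (hgate : ∀ t ∈ Ico 0 T, ∀ x : EuclideanSpace ℝ (Fin 3), cylRadius x < δ →
      -(C * ν) ≤ x 0 * u t x 0 + x 1 * u t x 1)
    (hsing : ¬ HasSmoothExtensionPast ν 0 u T) :
    ∃ (Mₛ : ℝ) (tn lamn : ℕ → ℝ) (cn : ℕ → EuclideanSpace ℝ (Fin 3)) (φ : ℕ → ℕ)
      (W : ℝ → EuclideanSpace ℝ (Fin 3) → EuclideanSpace ℝ (Fin 3)),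
      (∀ x, |swirl (u 0) x| ≤ Mₛ) ∧
      (∀ k, T / 2 ≤ tn k ∧ tn k < T) ∧ Tendsto tn atTop (𝓝 T) ∧ (∀ k, 0 < lamn k) ∧ Tendsto lamn atTop (𝓝 0) ∧
      (∀ k, ∀ t ∈ Icc 0 (tn k), ∀ x, lamn k / ν * ‖u t x‖ ≤ 1) ∧
      Tendsto (fun k => cylRadius (cn k)) atTop (𝓝 0) ∧
      StrictMono φ ∧ IsKNSSBlowupLimit W ∧
      (∀ s < 0, TendstoLocallyUniformly
        (fun k => ((lamn (φ k) / ν) • stPull (lamn (φ k) ^ 2 / ν) (lamn (φ k)) (tn (φ k)) (cn (φ k)) u) s)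
          (W s) atTop) ∧
      ((∃ c : EuclideanSpace ℝ (Fin 3), ‖c‖ = 1 ∧ c 1 = 0 ∧ ∀ s < 0, ∀ y : EuclideanSpace ℝ (Fin 3), W s y = c) ∨
        ((∀ k, cn k 0 = 0 ∧ cn k 1 = 0) ∧
          ¬ Summit.NavierStokesRegularity.NavierStokesRegularity.AxisymmetricLiouvilleBoundedSwirl ∧
          (∀ s < 0, IsAxisymmetric (W s)) ∧
          (∀ s < 0, ∀ y : EuclideanSpace ℝ (Fin 3), |swirl (W s) y| ≤ Mₛ / ν) ∧
          (∃ s < 0, ∃ x : EuclideanSpace ℝ (Fin 3), W s x ≠ W s 0) ∧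
          (∃ s < 0, ∃ y : EuclideanSpace ℝ (Fin 3), swirl (W s) y ≠ 0) ∧
          (∃ ε : ℝ, 0 < ε ∧ ∀ R : ℝ, ∃ s < 0, ∃ x : EuclideanSpace ℝ (Fin 3),
            R ≤ cylRadius x ∧ ε < |swirl (W s) x|) ∧
          (∀ s < 0, ∀ y : EuclideanSpace ℝ (Fin 3), -C ≤ y 0 * W s y 0 + y 1 * W s y 1))) := by
  obtain ⟨Mₛ, tn, lamn, cn, xn, φ, W, hMₛ, htn, htT, hlam, hlam0, hgauge, -, -, -, -, -, hcyl, hφ, hW, hconv, -, -,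
    halt⟩ := innerObject_master_of_axisymBlowupWitness hν hT ⟨hcl, hsing⟩ hLH hdec (hax 0 ⟨le_rfl, hT⟩)
  refine ⟨Mₛ, tn, lamn, cn, φ, W, hMₛ, htn, htT, hlam, hlam0, hgauge, hcyl, hφ, hW, hconv, ?_⟩
  rcases halt with ⟨⟨c, hc1, hc0, hWc⟩, -⟩ | ⟨hax0, hnot, hWax, hWsw, hWnc, -, ⟨s₁, hs₁, y₁, hy₁, -⟩, -, -, -, hfar, -⟩
  · exact Or.inl ⟨c, hc1, hc0, hWc⟩
  · refine Or.inr ⟨hax0, hnot, hWax, hWsw, hWnc, ⟨s₁, hs₁, y₁, hy₁⟩, hfar, ?_⟩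
    -- pointwise convergence of the zoom along `φ`, in the form of `zoomGate_onAxis_of_tendsto`
    have hpt : ∀ s < 0, ∀ y : EuclideanSpace ℝ (Fin 3), Tendsto
        (fun k => (lamn (φ k) / ν) • u (tn (φ k) + lamn (φ k) ^ 2 / ν * s) (cn (φ k) + lamn (φ k) • y))
        atTop (𝓝 (W s y)) := by
      intro s hs y
      have h := ((hconv s hs).tendstoLocallyUniformlyOn (s := univ)).tendsto_at (mem_univ y)
      refine h.congr fun k => ?_
      simp only [Pi.smul_apply, stPull_apply]
    exact zoomGate_onAxis_of_tendsto hν hT hδ hgate (fun k => htn (φ k)) (fun k => hlam (φ k))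
      (hlam0.comp hφ.tendsto_atTop) (fun k => hax0 (φ k)) hpt

/-! ## §3 By name: what a failure of the crux must produce -/

/-- **If `OneSidedRadialCriterion` fails, a gated singularity exists whose inner object is EITHER velocity-dominated (a unit
constant `c`, `c₁ = 0`) OR a counterexample to `AxisymmetricLiouvilleBoundedSwirl` obeying the global one-sided gate
`r W_r ≥ -C`** (with the gate constant `C` of the witness).  Structural consequence of `innerObject_gate_of_gatedBlowup`;
it names what a `C ≥ 2` counter-scenario must look like at the Kolmogorov scale. [folklore assembly of tree theorems] -/
theorem innerObject_of_not_oneSidedRadialCriterion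
    (h : ¬ Summit.NavierStokesRegularity.NavierStokesRegularity.Theses.TypeIIInviscidRelaxation.OneSidedRadialCriterion) :
    ∃ (ν T C : ℝ) (u : ℝ → EuclideanSpace ℝ (Fin 3) → EuclideanSpace ℝ (Fin 3))
      (W : ℝ → EuclideanSpace ℝ (Fin 3) → EuclideanSpace ℝ (Fin 3)) (Mₛ : ℝ),
      0 < ν ∧ 0 < T ∧ ¬ HasSmoothExtensionPast ν 0 u T ∧ (∀ x, |swirl (u 0) x| ≤ Mₛ) ∧ IsKNSSBlowupLimit W ∧
      ((∃ c : EuclideanSpace ℝ (Fin 3), ‖c‖ = 1 ∧ c 1 = 0 ∧ ∀ s < 0, ∀ y : EuclideanSpace ℝ (Fin 3), W s y = c) ∨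
        (¬ Summit.NavierStokesRegularity.NavierStokesRegularity.AxisymmetricLiouvilleBoundedSwirl ∧
          (∀ s < 0, IsAxisymmetric (W s)) ∧
          (∀ s < 0, ∀ y : EuclideanSpace ℝ (Fin 3), |swirl (W s) y| ≤ Mₛ / ν) ∧
          (∃ s < 0, ∃ x : EuclideanSpace ℝ (Fin 3), W s x ≠ W s 0) ∧
          (∃ s < 0, ∃ y : EuclideanSpace ℝ (Fin 3), swirl (W s) y ≠ 0) ∧
          (∃ ε : ℝ, 0 < ε ∧ ∀ R : ℝ, ∃ s < 0, ∃ x : EuclideanSpace ℝ (Fin 3),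
            R ≤ cylRadius x ∧ ε < |swirl (W s) x|) ∧
          (∀ s < 0, ∀ y : EuclideanSpace ℝ (Fin 3), -C ≤ y 0 * W s y 0 + y 1 * W s y 1))) := by
  unfold Summit.NavierStokesRegularity.NavierStokesRegularity.Theses.TypeIIInviscidRelaxation.OneSidedRadialCriterion at h
  push Not at h
  obtain ⟨ν, T, hν, hT, u, p, hcl, hLH, _hbd, hax, hdec, ⟨C, δ, hδ, hgate⟩, hsing⟩ := h
  obtain ⟨Mₛ, tn, lamn, cn, φ, W, hMₛ, -, -, -, -, -, -, -, hW, -, halt⟩ :=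
    innerObject_gate_of_gatedBlowup hν hT hδ hcl hLH hax hdec hgate hsing
  refine ⟨ν, T, C, u, W, Mₛ, hν, hT, hsing, hMₛ, hW, ?_⟩
  rcases halt with hα | ⟨-, hnot, hWax, hWsw, hWnc, hsw, hfar, hg⟩
  · exact Or.inl hα
  · exact Or.inr ⟨hnot, hWax, hWsw, hWnc, hsw, hfar, hg⟩

/-! ## §4 Conditional: a ONE-SIDED bounded-swirl Liouville statement forces the velocity-dominated branch -/

/-- **The one-sided bounded-swirl Liouville statement at level `C` is implied by (AX-L).**  The statement — every KNSS
blow-up limit with axisymmetric slices, bounded swirl AND the global one-sided gate `y₀W₀ + y₁W₁ ≥ -C` has a.e.-constant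
slices — is `AxisymmetricLiouvilleBoundedSwirl` with an extra hypothesis, hence formally WEAKER; it is the exact Liouville
input that kills branch (β) of `innerObject_gate_of_gatedBlowup`. [folklore] -/
theorem oneSidedLiouville_of_axisymmetricLiouvilleBoundedSwirl
    (hAXL : Summit.NavierStokesRegularity.NavierStokesRegularity.AxisymmetricLiouvilleBoundedSwirl) (C : ℝ) :
    ∀ W : ℝ → EuclideanSpace ℝ (Fin 3) → EuclideanSpace ℝ (Fin 3), IsKNSSBlowupLimit W →
      (∀ s < 0, IsAxisymmetric (W s)) → (∃ M : ℝ, ∀ s < 0, ∀ y, |swirl (W s) y| ≤ M) →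
      (∀ s < 0, ∀ y : EuclideanSpace ℝ (Fin 3), -C ≤ y 0 * W s y 0 + y 1 * W s y 1) →
      ∀ s < 0, ∃ b : EuclideanSpace ℝ (Fin 3), W s =ᵐ[MeasureTheory.volume] fun _ => b :=
  fun W hW hax hsw _ => hAXL W hW.isBoundedAncientMildSolution hW.aestronglyMeasurable hax hsw

/-- The slices of a KNSS blow-up limit are continuous. [folklore] -/
theorem continuous_slice_of_isKNSSBlowupLimit {W : ℝ → EuclideanSpace ℝ (Fin 3) → EuclideanSpace ℝ (Fin 3)}
    (hW : IsKNSSBlowupLimit W) {s : ℝ} (hs : s < 0) : Continuous (W s) := by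
  have h1 : ContinuousOn (uncurry W) (Iio 0 ×ˢ univ) := hW.smooth.continuousOn
  have h2 : Continuous fun y : EuclideanSpace ℝ (Fin 3) => ((s, y) : ℝ × EuclideanSpace ℝ (Fin 3)) := by fun_prop
  have h3 : ContinuousOn (fun y : EuclideanSpace ℝ (Fin 3) => uncurry W (s, y)) univ :=
    h1.comp h2.continuousOn fun y _ => ⟨hs, mem_univ y⟩
  exact continuousOn_univ.1 h3

/-- **Under the one-sided bounded-swirl Liouville statement at level `C`, every gated singularity with gate constant `C`
is velocity-dominated at the core scale** (any `ν > 0`): the inner object of `innerObject_gate_of_gatedBlowup` is of type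
(α) — the zoom converges along a subsequence to a unit constant `c` with `c₁ = 0` — because in branch (β) the limit would
be a gated, axisymmetric, bounded-swirl KNSS blow-up limit with a non-constant (continuous) slice.  With
`oneSidedLiouville_of_axisymmetricLiouvilleBoundedSwirl` this recovers, for gated witnesses, the tree's
`innerObject_typeAlpha_of_axisymBlowupWitness_under_axisymmetricLiouville` from a WEAKER Liouville input.
[cite: KochNadirashviliSereginSverak2009, §5–§6] -/
theorem innerObject_typeAlpha_of_gatedBlowup_under_oneSidedLiouville {ν T C δ : ℝ}
    (hL : ∀ W : ℝ → EuclideanSpace ℝ (Fin 3) → EuclideanSpace ℝ (Fin 3), IsKNSSBlowupLimit W →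
      (∀ s < 0, IsAxisymmetric (W s)) → (∃ M : ℝ, ∀ s < 0, ∀ y, |swirl (W s) y| ≤ M) →
      (∀ s < 0, ∀ y : EuclideanSpace ℝ (Fin 3), -C ≤ y 0 * W s y 0 + y 1 * W s y 1) →
      ∀ s < 0, ∃ b : EuclideanSpace ℝ (Fin 3), W s =ᵐ[MeasureTheory.volume] fun _ => b)
    (hν : 0 < ν) (hT : 0 < T) (hδ : 0 < δ)
    {u : ℝ → (EuclideanSpace ℝ (Fin 3)) → (EuclideanSpace ℝ (Fin 3))} {p : ℝ → (EuclideanSpace ℝ (Fin 3)) → ℝ}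
    (hcl : IsClassicalNSSolutionOn (Ico 0 T) ν 0 u p) (hLH : IsLerayHopfOn T ν 0 (u 0) u)
    (hax : ∀ t ∈ Ico 0 T, IsAxisymmetric (u t)) (hdec : HasRapidSpatialDecay (u 0))
    (hgate : ∀ t ∈ Ico 0 T, ∀ x : EuclideanSpace ℝ (Fin 3), cylRadius x < δ →
      -(C * ν) ≤ x 0 * u t x 0 + x 1 * u t x 1)
    (hsing : ¬ HasSmoothExtensionPast ν 0 u T) :
    ∃ (tn lamn : ℕ → ℝ) (cn : ℕ → EuclideanSpace ℝ (Fin 3)) (φ : ℕ → ℕ)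
      (W : ℝ → EuclideanSpace ℝ (Fin 3) → EuclideanSpace ℝ (Fin 3)) (c : EuclideanSpace ℝ (Fin 3)),
      (∀ k, T / 2 ≤ tn k ∧ tn k < T) ∧ Tendsto tn atTop (𝓝 T) ∧ (∀ k, 0 < lamn k) ∧ Tendsto lamn atTop (𝓝 0) ∧
      (∀ k, ∀ t ∈ Icc 0 (tn k), ∀ x, lamn k / ν * ‖u t x‖ ≤ 1) ∧
      Tendsto (fun k => cylRadius (cn k)) atTop (𝓝 0) ∧
      StrictMono φ ∧ IsKNSSBlowupLimit W ∧
      (∀ s < 0, TendstoLocallyUniformly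
        (fun k => ((lamn (φ k) / ν) • stPull (lamn (φ k) ^ 2 / ν) (lamn (φ k)) (tn (φ k)) (cn (φ k)) u) s)
          (W s) atTop) ∧
      ‖c‖ = 1 ∧ c 1 = 0 ∧ ∀ s < 0, ∀ y : EuclideanSpace ℝ (Fin 3), W s y = c := by
  obtain ⟨Mₛ, tn, lamn, cn, φ, W, -, htn, htT, hlam, hlam0, hgauge, hcyl, hφ, hW, hconv, halt⟩ :=
    innerObject_gate_of_gatedBlowup hν hT hδ hcl hLH hax hdec hgate hsing
  rcases halt with ⟨c, hc1, hc0, hWc⟩ | ⟨-, -, hWax, hWsw, ⟨s₁, hs₁, x₁, hx₁⟩, -, -, hg⟩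
  · exact ⟨tn, lamn, cn, φ, W, c, htn, htT, hlam, hlam0, hgauge, hcyl, hφ, hW, hconv, hc1, hc0, hWc⟩
  · exfalso
    obtain ⟨b, hb⟩ := hL W hW hWax ⟨Mₛ / ν, hWsw⟩ hg s₁ hs₁
    have heq : W s₁ = fun _ => b :=
      (Continuous.ae_eq_iff_eq MeasureTheory.volume (continuous_slice_of_isKNSSBlowupLimit hW hs₁) continuous_const).1 hb
    exact hx₁ (by rw [heq])

end Summit.NavierStokesRegularity.NavierStokesRegularity.Theorems.OneSidedZoomGate

end
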